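import Summits.BirchSwinnertonDyer.BirchSwinnertonDyer.Theses.TangentCone
import Literature.NumberTheory.EllipticCurves.PadicSeriesEvaluation

/-!
# Sketch — crux ideas for `TangentCone.EdgeCap` (stmt-BirchSwinnertonDyer-17609), ideator k=2, round 1

First lemmas of two crux idea cards (they need not be proved; they must elaborate):

* card `selmer-depth-ladder` — (L1) `deepCongruence`: on a (Br)-isolated branch the congruence
  between the weight-`k` member `g_k` and `E` has DEPTH `1 + v_p(k-2)` (trace shadow of
  `T_{g_k}/p^{m+1} ≅ T_pE/p^{m+1}`), and (L1b) `branchMember_coeff_mem_range`: its Hecke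
  eigenvalues are `p`-ADIC RATIONALS (`𝕋_𝔪 ≅ Λ`), which is what makes Kato's hypothesis (12.5.2)
  automatic for every member; (L3) `arcBound_of_deepPointwise`: the p-adic-analytic glue turning
  the ladder's POINTWISE cap at deep classical arc points into clause (iii) of the registered
  stub `stub_ratioInterpolant` of line `ratio_measure_strassmann`.
* card `lambda-survives-vertical-zeros` — (L2) `uniformReference_of_isPadicInt`: for ANY integral
  two-variable series (vertical zeros allowed) the best of `2J+1` cyclotomic reference values on a
  weight fibre is within `p^{-C}` of the sup of that fibre, uniformly in the fibre (λ is bounded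
  across vertical zeros, μ is not — and μ cancels in the crux's ratios).
-/

noncomputable section

open scoped Classical

namespace Summit.BirchSwinnertonDyer.BirchSwinnertonDyer.Cruxes.EdgeCap.SelmerDepthLadder

open Literature Literature.NumberTheory.EllipticCurves
open Literature.NumberTheory.EllipticCurves.ModularForms

/-- (L1) **Deep congruence along an isolated Hida branch.** Under EdgeCap's admissibility
hypotheses at `p` (in particular the isolation hypothesis (Br), which gives `𝕋_𝔪 ≅ Λ = ℤ_p⟦X⟧`),
every ordinary newform `g ∈ S_k(Γ₀(N_E))`, `k ≡ 2 (mod 2(p-1))`, `k > 2`, congruent to `E` through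
`ι`, is congruent to `E` to DEPTH `1 + v_p(k-2)`: for every prime `ℓ ∤ N_E p`,
`‖ι(a_ℓ(g)) - a_ℓ(E)‖ ≤ p^{-(1+v_p(k-2))}`. Reason: `a_ℓ(g) = T_ℓ(x_k)`, `a_ℓ(E) = T_ℓ(0)` for
the Λ-adic Hecke eigenvalue `T_ℓ ∈ ℤ_p⟦X⟧` of the branch and `x_k = (1+p)^{k-2} - 1`,
`v_p(x_k) = 1 + v_p(k-2)`. (Hida 1986; EPW 2005 Thm 2.1.2/2.2.2; the weight-2 rank-one control
that turns (Br) into `𝕋_𝔪 ≅ Λ`.) With Carayol/Chebotarev this is `T_g/p^{m+1} ≅ T_pE/p^{m+1}`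
as `G_ℚ`-modules, the first rung of the Selmer depth ladder. -/
theorem deepCongruence :
    ∀ (W : WeierstrassCurve ℚ) [W.IsElliptic] [W.IsGloballyMinimal] (_ : NeZero (W.conductorNorm ℤ))
      (p : ℕ) [Fact p.Prime], 5 ≤ p → W.HasGoodReductionAtPrime p → ¬ (p : ℤ) ∣ W.frobeniusTrace p →
      ¬ (p : ℤ) ∣ (W.frobeniusTrace p) ^ 2 - 1 → W.HasSurjectiveModNGaloisRep p →
      (∀ (M : ℕ) (_ : NeZero M) (g : CuspForm (CongruenceSubgroup.Gamma0 M) 2)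
          (ι : coeffField g →+* PadicAlgCl p), M ∣ W.conductorNorm ℤ * p → IsNewform0 g →
          ‖ι ⟨(UpperHalfPlane.qExpansion 1 ⇑g).coeff p, coeff_mem_coeffField g p⟩‖ = 1 →
          (∀ ℓ : ℕ, ℓ.Prime → ¬ ℓ ∣ W.conductorNorm ℤ * p →
            ‖ι ⟨(UpperHalfPlane.qExpansion 1 ⇑g).coeff ℓ, coeff_mem_coeffField g ℓ⟩ -
              ((W.frobeniusTrace ℓ : ℤ) : PadicAlgCl p)‖ < 1) →
          M = W.conductorNorm ℤ ∧ ∀ n : ℕ, (UpperHalfPlane.qExpansion 1 ⇑g).coeff n = ((W.LFunction n : ℤ) : ℂ)) →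
      ∀ (k : ℤ) (g : CuspForm (CongruenceSubgroup.Gamma0 (W.conductorNorm ℤ)) k)
        (ι : coeffField g →+* PadicAlgCl p),
        (2 * (p - 1) : ℤ) ∣ (k - 2) → 2 < k → IsNewform0 g →
        ‖ι ⟨(UpperHalfPlane.qExpansion 1 ⇑g).coeff p, coeff_mem_coeffField g p⟩‖ = 1 →
        (∀ ℓ : ℕ, ℓ.Prime → ¬ ℓ ∣ W.conductorNorm ℤ * p →
          ‖ι ⟨(UpperHalfPlane.qExpansion 1 ⇑g).coeff ℓ, coeff_mem_coeffField g ℓ⟩ -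
            ((W.frobeniusTrace ℓ : ℤ) : PadicAlgCl p)‖ < 1) →
        ∀ ℓ : ℕ, ℓ.Prime → ¬ ℓ ∣ W.conductorNorm ℤ * p →
          ‖ι ⟨(UpperHalfPlane.qExpansion 1 ⇑g).coeff ℓ, coeff_mem_coeffField g ℓ⟩ -
              ((W.frobeniusTrace ℓ : ℤ) : PadicAlgCl p)‖ ≤
            (p : ℝ) ^ (-(1 + padicValInt p (k - 2) : ℤ)) := by
  sorry

/-- (L1b) **Members of an isolated branch have `p`-adically rational eigenvalues.** Under the
same hypotheses, `ι(a_n(g)) ∈ ℚ_p ⊂ \bar ℚ_p` for every `n` (because `𝕋_𝔪 ≅ Λ` and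
`a_n(g) = T_n((1+p)^{k-2}-1)`); hence the lattice `T_g` is a rank-two `ℤ_p`-module with
`ρ̄_g = ρ̄_{E,p}` surjective, and for `p ≥ 5` the image of `G_{ℚ(μ_{p^∞})}` contains `SL₂(ℤ_p)`
(Serre's lemma + perfectness of `SL₂(ℤ_p)`) — Kato's condition (12.5.2) for EVERY member,
without Mazur–Wiles fullness in the family. -/
theorem branchMember_coeff_mem_range :
    ∀ (W : WeierstrassCurve ℚ) [W.IsElliptic] [W.IsGloballyMinimal] (_ : NeZero (W.conductorNorm ℤ))
      (p : ℕ) [Fact p.Prime], 5 ≤ p → W.HasGoodReductionAtPrime p → ¬ (p : ℤ) ∣ W.frobeniusTrace p →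
      ¬ (p : ℤ) ∣ (W.frobeniusTrace p) ^ 2 - 1 → W.HasSurjectiveModNGaloisRep p →
      (∀ (M : ℕ) (_ : NeZero M) (g : CuspForm (CongruenceSubgroup.Gamma0 M) 2)
          (ι : coeffField g →+* PadicAlgCl p), M ∣ W.conductorNorm ℤ * p → IsNewform0 g →
          ‖ι ⟨(UpperHalfPlane.qExpansion 1 ⇑g).coeff p, coeff_mem_coeffField g p⟩‖ = 1 →
          (∀ ℓ : ℕ, ℓ.Prime → ¬ ℓ ∣ W.conductorNorm ℤ * p →
            ‖ι ⟨(UpperHalfPlane.qExpansion 1 ⇑g).coeff ℓ, coeff_mem_coeffField g ℓ⟩ -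
              ((W.frobeniusTrace ℓ : ℤ) : PadicAlgCl p)‖ < 1) →
          M = W.conductorNorm ℤ ∧ ∀ n : ℕ, (UpperHalfPlane.qExpansion 1 ⇑g).coeff n = ((W.LFunction n : ℤ) : ℂ)) →
      ∀ (k : ℤ) (g : CuspForm (CongruenceSubgroup.Gamma0 (W.conductorNorm ℤ)) k)
        (ι : coeffField g →+* PadicAlgCl p),
        ((p - 1 : ℕ) : ℤ) ∣ (k - 2) → 2 < k → IsNewform0 g →
        ‖ι ⟨(UpperHalfPlane.qExpansion 1 ⇑g).coeff p, coeff_mem_coeffField g p⟩‖ = 1 →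
        (∀ ℓ : ℕ, ℓ.Prime → ¬ ℓ ∣ W.conductorNorm ℤ * p →
          ‖ι ⟨(UpperHalfPlane.qExpansion 1 ⇑g).coeff ℓ, coeff_mem_coeffField g ℓ⟩ -
            ((W.frobeniusTrace ℓ : ℤ) : PadicAlgCl p)‖ < 1) →
        ∀ n : ℕ, ι ⟨(UpperHalfPlane.qExpansion 1 ⇑g).coeff n, coeff_mem_coeffField g n⟩ ∈
          Set.range (algebraMap ℚ_[p] (PadicAlgCl p)) := by
  sorry

/-- (L2) **λ survives vertical zeros: uniform reference index for ANY integral two-variable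
series.** For an integral `F ∈ ℤ_p⟦X,Y⟧` (vertical divisors `(X - κ)` and `p`-power content
allowed) there are `J, C` such that on EVERY weight fibre `x` of the open unit disc the largest of
the reference values `|F(x, y_j)|`, `y_j = (1+p)^{j-1} - 1`, `j` odd, `3 ≤ j ≤ 2J+1`,
`(p-1) ∣ (j-1)`, is within a factor `p^{-C}` of the supremum of `|F(x, ·)|` on the disc: the
number of zeros `λ(F(x,·))` of a non-zero fibre is bounded on the compact disc (upper
semicontinuous even at vertical zeros, where only `μ` blows up), and `μ(F(x,·))` cancels between
the two sides. Replaces clause (i) "no vertical zero fibre" + `fibreStrassmann` +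
`uniformReference` of line `ratio_measure_strassmann` in the RATIO setting of the crux. -/
theorem uniformReference_of_isPadicInt (p : ℕ) [Fact p.Prime]
    (F : MvPowerSeries (Fin 2) ℚ_[p]) (hF : IsPadicInt F) :
    ∃ J C : ℕ, ∀ x : ℚ_[p], ‖x‖ < 1 →
      ∃ j : ℕ, Odd j ∧ 3 ≤ j ∧ (p - 1) ∣ (j - 1) ∧ j ≤ 2 * J + 1 ∧
        ∀ y' : ℚ_[p], ‖y'‖ < 1 →
          ‖padicEval₂ F x y'‖ ≤
            ‖padicEval₂ F x ((1 + (p : ℚ_[p])) ^ (j - 1) - 1)‖ * (p : ℝ) ^ C := by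
  sorry

/-- (L3) **Accumulation: a pointwise cap at deep classical arc points gives the arc order.**
If an integral `F` satisfies the decay `|F(arc t)| · p^{s(v_p(t)+1)} ≤ p^C` at classical arc
points `arc t = ((1+p)^{bt}-1, (1+p)^{at}-1)` of arbitrarily large depth `v_p(t)`, then
`T^s ∣ F ∘ arc` in `ℤ_p⟦T⟧` (`arc(T) = ((1+T)^b-1, (1+T)^a-1)`), whence clause (iii) of
`stub_ratioInterpolant` verbatim: `|F(arc t)| ≤ |t|_p^s` for ALL `t`. This is how the Selmer
depth ladder (which bounds single values, never orders of vanishing) feeds the registered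
line. (`p` odd: `v_p((1+p)^t - 1) = 1 + v_p(t)`.) -/
theorem arcBound_of_deepPointwise (p : ℕ) [Fact p.Prime] (hp : p ≠ 2)
    (F : MvPowerSeries (Fin 2) ℚ_[p]) (hF : IsPadicInt F) (a b s C : ℕ) (hb : 0 < b)
    (h : ∀ m : ℕ, ∃ t : ℕ, 0 < t ∧ m ≤ padicValNat p t ∧
      ‖padicEval₂ F ((1 + (p : ℚ_[p])) ^ (b * t) - 1) ((1 + (p : ℚ_[p])) ^ (a * t) - 1)‖ *
          (p : ℝ) ^ (s * (padicValNat p t + 1)) ≤ (p : ℝ) ^ C) :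
    ∀ t : ℕ, ‖padicEval₂ F ((1 + (p : ℚ_[p])) ^ (b * t) - 1) ((1 + (p : ℚ_[p])) ^ (a * t) - 1)‖ ≤
      ‖(t : ℚ_[p])‖ ^ s := by
  sorry

end Summit.BirchSwinnertonDyer.BirchSwinnertonDyer.Cruxes.EdgeCap.SelmerDepthLadder

end
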